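import Summits.AtomisticToContinuum.FouriersLaw.Theorems.EmbeddedDrudeMourreGreenKuboContinuationMnRecurrence
import HarnessLib

/-!
# Bounded Jacobi coefficients force compact support

Helper for the line `FilterInvariance` of the crux `EmbeddedDrudeMourre.GreenKuboContinuation`
(stub `stub_mnCompactSupport`, wave 2 of the general Máté–Nevai theorem): if every polynomial
is `τ`-integrable and `p : ℕ → ℝ[X]` is an orthonormal polynomial sequence of `τ`
(`natDegree (p n) = n`, positive leading coefficients `k_n`, `∫ p_m p_n dτ = δ_{mn}`) obeying a
three-term recurrence

  `X p_0 = A_0 p_1 + B_0 p_0`, `X p_{n+1} = A_{n+1} p_{n+2} + B_{n+1} p_{n+1} + A_n p_n`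

with bounded coefficients `|A_n|, |B_n| ≤ M`, then `τ` is carried by a compact interval:
`τ ([-R, R]ᶜ) = 0` for some `R` (the spectral measure of a bounded Jacobi matrix lives in
`[-‖J‖, ‖J‖]`).

Proof (self-contained; the support of the spectral measure of a bounded Jacobi matrix lies in
`[-‖J‖, ‖J‖]`): by induction on `k`, feeding the recurrence into
`ω^{k+1} p_i p_j = ω^k (ω p_i) p_j`, one gets `|∫ ω^k p_i p_j dτ| ≤ (3M)^k` for all `i, j`
(`mnCS_abs_integral_pow_mul_le`); with `p_0 ≡ c₀ > 0` this is the moment bound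
`c₀² ∫ ω^{2k} dτ ≤ (3M)^{2k}`, and Markov's inequality at level `R^{2k}`, `R = 3M + 1`, gives
`τ {R ≤ |ω|} ≤ c₀⁻² (3M/R)^{2k} → 0`. The same statement with the intrinsic coefficients
`k_n / k_{n+1}`, `∫ ω p_n² dτ` is `Literature.Analysis.Approximation.MateNevai.exists_ae_abs_le`.
-/

noncomputable section

namespace Summit.AtomisticToContinuum.FouriersLaw.Theorems.GreenKuboContinuation.BandLimitedKrylov

open Filter Topology MeasureTheory Set Polynomial

section OrthonormalPolySeq

variable {τ : Measure ℝ} {p : ℕ → ℝ[X]} {A B : ℕ → ℝ} {M : ℝ}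

/-- `ω ↦ ω^k f(ω) g(ω)` is `τ`-integrable for polynomials `f`, `g` when all polynomial functions
are. -/
theorem mnCS_integrable_pow_mul (hint : ∀ f : ℝ[X], Integrable (fun ω => f.eval ω) τ)
    (k : ℕ) (f g : ℝ[X]) : Integrable (fun ω => ω ^ k * (f.eval ω * g.eval ω)) τ := by
  have h := hint (X ^ k * (f * g))
  simp only [eval_mul, eval_pow, eval_X] at h
  exact h

/-- **Moment growth from bounded recurrence coefficients.** If `p` is orthonormal and obeys
`X p_n = A_n p_{n+1} + B_n p_n + A_{n-1} p_{n-1}` with `|A_n|, |B_n| ≤ M`, then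
`|∫ ω^k p_i(ω) p_j(ω) dτ| ≤ (3M)^k` for all `k, i, j` (the matrix entries of `J^k` for the
Jacobi matrix `J`, `‖J‖ ≤ 3M`). -/
theorem mnCS_abs_integral_pow_mul_le (hint : ∀ f : ℝ[X], Integrable (fun ω => f.eval ω) τ)
    (hporth : ∀ m n, ∫ ω, (p m).eval ω * (p n).eval ω ∂τ = if m = n then 1 else 0)
    (hrec0 : X * p 0 = C (A 0) * p 1 + C (B 0) * p 0)
    (hrec : ∀ n, X * p (n + 1) =
      C (A (n + 1)) * p (n + 2) + C (B (n + 1)) * p (n + 1) + C (A n) * p n)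
    (hA : ∀ n, |A n| ≤ M) (hB : ∀ n, |B n| ≤ M) (k i j : ℕ) :
    |∫ ω, ω ^ k * ((p i).eval ω * (p j).eval ω) ∂τ| ≤ (3 * M) ^ k := by
  induction k generalizing i j with
  | zero =>
    simp only [pow_zero, one_mul]
    rw [hporth]
    split_ifs
    · rw [abs_one]
    · rw [abs_zero]
      exact zero_le_one
  | succ k ih =>
    have hM : 0 ≤ M := (abs_nonneg _).trans (hA 0)
    have hI := mnCS_integrable_pow_mul (τ := τ) hint k
    -- one step: `ω p_i = a p_{i₁} + b p_{i₂} + c p_{i₃}` with `|a|, |b|, |c| ≤ M`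
    have key : ∀ (a b c : ℝ) (i₁ i₂ i₃ : ℕ), |a| ≤ M → |b| ≤ M → |c| ≤ M →
        (∀ ω, ω * (p i).eval ω = a * (p i₁).eval ω + b * (p i₂).eval ω + c * (p i₃).eval ω) →
        |∫ ω, ω ^ (k + 1) * ((p i).eval ω * (p j).eval ω) ∂τ| ≤ (3 * M) ^ (k + 1) := by
      intro a b c i₁ i₂ i₃ ha hb hc he
      have e : ∀ ω, ω ^ (k + 1) * ((p i).eval ω * (p j).eval ω) =
          a * (ω ^ k * ((p i₁).eval ω * (p j).eval ω)) +
            b * (ω ^ k * ((p i₂).eval ω * (p j).eval ω)) +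
            c * (ω ^ k * ((p i₃).eval ω * (p j).eval ω)) := fun ω => by
        have h' : ω ^ (k + 1) * ((p i).eval ω * (p j).eval ω) =
            ω ^ k * ((ω * (p i).eval ω) * (p j).eval ω) := by ring
        rw [h', he ω]
        ring
      have i12 : Integrable (fun ω => a * (ω ^ k * ((p i₁).eval ω * (p j).eval ω)) +
          b * (ω ^ k * ((p i₂).eval ω * (p j).eval ω))) τ :=
        ((hI _ _).const_mul _).add ((hI _ _).const_mul _)
      simp_rw [e]
      rw [integral_add i12 ((hI _ _).const_mul _),
        integral_add ((hI _ _).const_mul _) ((hI _ _).const_mul _), integral_const_mul,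
        integral_const_mul, integral_const_mul]
      calc _ ≤ |a * ∫ ω, ω ^ k * ((p i₁).eval ω * (p j).eval ω) ∂τ| +
            |b * ∫ ω, ω ^ k * ((p i₂).eval ω * (p j).eval ω) ∂τ| +
            |c * ∫ ω, ω ^ k * ((p i₃).eval ω * (p j).eval ω) ∂τ| := abs_add_three _ _ _
        _ ≤ M * (3 * M) ^ k + M * (3 * M) ^ k + M * (3 * M) ^ k := by
          rw [abs_mul, abs_mul, abs_mul]
          exact add_le_add (add_le_add (mul_le_mul ha (ih _ _) (abs_nonneg _) hM)
            (mul_le_mul hb (ih _ _) (abs_nonneg _) hM)) (mul_le_mul hc (ih _ _) (abs_nonneg _) hM)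
        _ = (3 * M) ^ (k + 1) := by ring
    rcases i with _ | n
    · refine key (A 0) (B 0) 0 1 0 0 (hA 0) (hB 0) (by rw [abs_zero]; exact hM) fun ω => ?_
      have h := congrArg (eval ω) hrec0
      simp only [eval_mul, eval_X, eval_add, eval_C] at h
      rw [h, zero_mul, add_zero]
    · refine key (A (n + 1)) (B (n + 1)) (A n) (n + 2) (n + 1) n (hA _) (hB _) (hA _) fun ω => ?_
      have h := congrArg (eval ω) (hrec n)
      simp only [eval_mul, eval_X, eval_add, eval_C] at h
      exact h

end OrthonormalPolySeq

/-- **`stub_mnCompactSupport` — bounded Jacobi coefficients force compact support.** If every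
polynomial is `τ`-integrable, `p_n` is an orthonormal polynomial sequence of `τ` (`deg p_n = n`,
`k_n > 0`) obeying the three-term recurrence `x p_0 = A_0 p_1 + B_0 p_0`,
`x p_{n+1} = A_{n+1} p_{n+2} + B_{n+1} p_{n+1} + A_n p_n` with `|A_n|, |B_n| ≤ M`, then `τ` is
carried by `[-R, R]`, `R = 3M + 1`: by `mnCS_abs_integral_pow_mul_le` and `p_0 ≡ c₀ > 0`,
`c₀² ∫ x^{2k} dτ ≤ (3M)^{2k}`, and Markov's inequality gives
`τ {R ≤ |x|} ≤ c₀⁻² (3M/R)^{2k} → 0` (the support of the spectral measure of a bounded Jacobi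
matrix lies in `[-‖J‖, ‖J‖]`). [folklore] -/
theorem stub_mnCompactSupport :
    ∀ (τ : Measure ℝ) (p : ℕ → ℝ[X]) (A B : ℕ → ℝ) (M : ℝ),
      (∀ f : ℝ[X], Integrable (fun ω => f.eval ω) τ) →
      (∀ n, (p n).natDegree = n) → (∀ n, 0 < (p n).leadingCoeff) →
      (∀ m n, ∫ ω, (p m).eval ω * (p n).eval ω ∂τ = if m = n then 1 else 0) →
      X * p 0 = C (A 0) * p 1 + C (B 0) * p 0 →
      (∀ n, X * p (n + 1) = C (A (n + 1)) * p (n + 2) + C (B (n + 1)) * p (n + 1) + C (A n) * p n) →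
      (∀ n, |A n| ≤ M) → (∀ n, |B n| ≤ M) →
      ∃ R : ℝ, τ (Set.Icc (-R) R)ᶜ = 0 := by
  intro τ p A B M hint hpdeg hplc hporth hrec0 hrec hA hB
  have hM : 0 ≤ M := (abs_nonneg _).trans (hA 0)
  haveI : IsFiniteMeasure τ := by
    have h1 := hint (C 1)
    simp only [eval_C] at h1
    exact (integrable_const_iff.1 h1).resolve_left one_ne_zero
  -- `p 0` is the constant `c₀ > 0`
  obtain ⟨c₀, hc₀, hp0⟩ : ∃ c₀ : ℝ, 0 < c₀ ∧ ∀ ω, (p 0).eval ω = c₀ :=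
    ⟨(p 0).leadingCoeff, hplc 0, fun ω => by
      rw [← coeff_natDegree, eval_eq_sum_range, hpdeg 0, Finset.sum_range_succ,
        Finset.sum_range_zero, zero_add, pow_zero, mul_one]⟩
  -- even moments: `c₀² ∫ ω^{2k} dτ ≤ (3M)^{2k}`
  have hmom : ∀ k : ℕ, (∫ ω, ω ^ (2 * k) ∂τ) * (c₀ * c₀) ≤ (3 * M) ^ (2 * k) := fun k => by
    have h := (le_abs_self _).trans
      (mnCS_abs_integral_pow_mul_le hint hporth hrec0 hrec hA hB (2 * k) 0 0)
    simp_rw [hp0] at h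
    rwa [integral_mul_const] at h
  set R : ℝ := 3 * M + 1 with hR
  have hR0 : 0 < R := by linarith
  refine ⟨R, ?_⟩
  set S : Set ℝ := {ω | R ≤ |ω|} with hS
  -- Markov at level `R^{2k}`
  have hmarkov : ∀ k : ℕ, R ^ (2 * k) * τ.real S ≤ ∫ ω, ω ^ (2 * k) ∂τ := fun k => by
    have hint2k : Integrable (fun ω : ℝ => ω ^ (2 * k)) τ := by
      simpa only [eval_pow, eval_X] using hint (X ^ (2 * k))
    have h := mul_meas_ge_le_integral_of_nonneg
      (Eventually.of_forall fun ω => (even_two_mul k).pow_nonneg ω) hint2k (R ^ (2 * k))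
    refine le_trans (mul_le_mul_of_nonneg_left (measureReal_mono fun ω hω => ?_)
      (pow_pos hR0 _).le) h
    show R ^ (2 * k) ≤ ω ^ (2 * k)
    rw [← (even_two_mul k).pow_abs ω]
    exact pow_le_pow_left₀ hR0.le hω _
  have hbound : ∀ k : ℕ, τ.real S ≤ (c₀ * c₀)⁻¹ * (((3 * M) / R) ^ 2) ^ k := fun k => by
    have hRk : 0 < R ^ (2 * k) := pow_pos hR0 _
    calc τ.real S ≤ (∫ ω, ω ^ (2 * k) ∂τ) / R ^ (2 * k) := (le_div_iff₀' hRk).2 (hmarkov k)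
      _ ≤ ((3 * M) ^ (2 * k) / (c₀ * c₀)) / R ^ (2 * k) :=
          div_le_div_of_nonneg_right ((le_div_iff₀ (mul_pos hc₀ hc₀)).2 (hmom k)) hRk.le
      _ = (c₀ * c₀)⁻¹ * (((3 * M) / R) ^ 2) ^ k := by rw [← pow_mul, div_pow]; ring
  -- the bound tends to `0`
  have hq1 : ((3 * M) / R) ^ 2 < 1 :=
    pow_lt_one₀ (div_nonneg (by linarith) hR0.le) ((div_lt_one hR0).2 (by linarith)) two_ne_zero
  have hlim : Tendsto (fun k : ℕ => (c₀ * c₀)⁻¹ * (((3 * M) / R) ^ 2) ^ k) atTop (𝓝 0) := by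
    simpa only [mul_zero] using
      (tendsto_pow_atTop_nhds_zero_of_lt_one (sq_nonneg _) hq1).const_mul (c₀ * c₀)⁻¹
  have hS0 : τ S = 0 := (measureReal_eq_zero_iff (measure_ne_top τ S)).1
    (le_antisymm (ge_of_tendsto' hlim hbound) measureReal_nonneg)
  refine measure_mono_null (fun ω hω => ?_) hS0
  have hω' : ¬ |ω| ≤ R := fun habs => hω (mem_Icc.2 (abs_le.1 habs))
  exact (not_le.1 hω').le

end Summit.AtomisticToContinuum.FouriersLaw.Theorems.GreenKuboContinuation.BandLimitedKrylov

end
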